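import Summits.QuantumFields.BalabanUV.T4Continuum.Support.NE7MeanZeroGaugeSupPoincare
import HarnessLib

/-!
# NE7GaugeFunctionSupLetter — THE SUP LETTER OF A GAUGE FUNCTION FROM ITS COVARIANT GRADIENT AND ITS NESTED BLOCK MEAN (memo ROAD-G100 §2.4 (iv), THE size bound of the
# spike-free slice gauge function): in the multi-level small-field class, `‖bmeanIterW L (j+1) W ξ‖ ≤ m` and `‖gaugeDir W ξ‖ ≤ G` everywhere ⟹
# `sup‖ξ‖ ≤ (m + 2d(M−1)·G)∕(1 − θ)`, `θ ≍ b∕L²` — k-FREE, N-FREE; hence, for the linear `𝒯_E`-split `T = Ỹ + gaugeDir W ζ` with `bmeanIterW ζ = −(framePotW T − h)`,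
# `sup‖ζ‖ ≤ (sup‖framePotW T − h‖ + 2d(M−1)·(sup‖T‖ + sup‖Ỹ‖))∕(1 − θ)` — ONE factor `M`, no decomposition of `ζ` needed

Cell `pub-balaban`, rung (B)+1 sub-cell t4, lineage `b2b-balaban-t4-ne7-p1`, generation 100 (CRUX PROVER NE7 #1 = OWNER of BINDER row NE7).  Memo `t4/b2b-balaban-t4-ne7-p1-g100/ROAD-G100.md` §2.4:
the (S1) contraction needs `sup‖ζ(u)‖ ≤ C_ζ·M·(sup‖T(u)‖ + sup‖Ỹ(u)‖) + ‖h(u)‖` for the gauge function of the linear slice split.  The split (`NE7NestedCovariantExtension.exists_fullGauge_split_general`,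
p762499) gives `ζ = −(ζ₁ + η)` with `bmeanIterW ζ₁ = framePotW T − h` EXACTLY and `η ∈ Ξ_Q(W)` (nested mean zero), so `bmeanIterW ζ = −(framePotW T − h)` (`NE3FrameFreeSliceW.bmeanIterW_add`), while the
TOTAL gradient `gaugeDir W ζ = T − Ỹ` is small on EVERY bond.  THIS FILE is the letter that turns these two facts into the sup bound — p762414's staircase∕corner∕bridge argument with
«nested mean = 0» relaxed to «nested mean ≤ m»; no in-block analysis of `ζ₁` is needed.
WHAT ([folklore]; 0 def, 0 sorry).  §1 **`norm_le_of_bmeanIterW_le`**: `‖ξ y‖ ≤ m + θ_b·S + 2d(M−1)·(G + 2(d−1)(M−1)x·S)` for every `y` (`S ≥ sup‖ξ‖`, `θ_b` the bridge constant).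
§2 **`sup_le_of_bmeanIterW_le`** (THE LETTER): `ξ` `P`-periodic, `θ := θ_b + 4d(d−1)(M−1)²x < 1` ⟹ `∀ y, ‖ξ y‖ ≤ (m + 2d(M−1)·G)∕(1 − θ)`.
§3 **`sup_gauge_of_split`**: the reading for a split `T = Ỹ + gaugeDir W ζ` with `‖bmeanIterW ζ‖ ≤ m`: `∀ y, ‖ζ y‖ ≤ (m + 2d(M−1)·(S_T + S_Ỹ))∕(1 − θ)`.
HONEST FRAMING (page 1): covariant kinematics at ONE background in the cell's typed class; nothing of Bałaban's asserted; NOT (S1), NOT NE7; spine 0∕9; finite T⁴ rung (B)+1 — NOT infinite volume,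
NOT mass gap, NOT BetaPertH, NOT Clay.  Continuum YM on T⁴ ⇐ BetaPertH ∧ nine spine estimates (0/9 proved); BetaPertH ⇐ (D1) ∧ (D4) ∧ CAP+tail; G-an2-4 gates asym, D1 and NE2/3/4.
-/

set_option autoImplicit false

open scoped BigOperators Matrix.Norms.L2Operator
open Finset

namespace Summit.QuantumFields.BalabanUV.T4Continuum.NE7GaugeFunctionSupLetter

open Literature.MathematicalPhysics.QuantumFieldTheory.Balaban1983to89
open B7Prop1Explicit B7Prop2Explicit
open T4AveragingDeficitWall (IsUnitaryCfg SmallField Ad)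
open T4AveragingDeficitWallBoundary (periodBox mem_periodBox card_periodBox)
open T4AveragingDeficitNonAbelian (Ad_mul Ad_sub)
open AveragingDeficitTransport (norm_Ad_of_unitary mem_U1_of_unitary)
open AveragingDeficitNearIdentity (Ad_one norm_Ad_sub_le)
open AveragingDeficitTwoLevelPrep (prop1Radius)
open AveragingDeficitMultiLevelPrep (LevelSmall)
open AveragingDeficitBlockDensity (btree btree_mem)
open BlockAveragePushDirGauge (gaugeDir)
open NE3TangentNoGoWords (dPot asum_dPot)
open NE3CombGauge (btree_corner isUnitaryCfg_comb)
open NE3CombGaugeCharge (gaugeDir_gaugeAct_eq)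
open NE3CovariantSliceOrthogonality (gaugeDir_eq_neg_dPot_add_defect)
open NE3CovariantBlockPoincare (Ad_inv_Ad)
open NE3CovariantBlockMean (bmeanW bmeanIterW boxVec_bounds)
open NE3NestedBlockMeanCovariance (comb_nearOne bmeanW_eq_bmean_comb)
open NE3NestedBlockMeanBridge (norm_bmeanIterW_sub_bmeanW_le)
open NE3FramePotGauge (bmean)
open NE3SmoothRightInverseBounds (norm_asum_le_of_steps)
open SmoothRefineBlocks (blk res blk_add_res res_nonneg res_le steps mem_steps_treeWord)
open SpreadLift (loopRad)
open NE3CovariantLineSumsError (iterate_prop1Radius_nonneg)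
open PeriodicChoice (apply_wrap_eq wrap_mem_periodBox)
open NE7MeanZeroGaugeSupPoincare (norm_le_corner_add norm_bmeanW_sub_corner_le)

noncomputable section

variable {d : ℕ} {n : Type*} [Fintype n] [DecidableEq n]

/-! ## §1 The pointwise bound with the sup data displayed -/

/-- **NESTED MEAN `≤ m` AND GRADIENT `≤ G` ⟹ POINTWISE BOUND** (multi-level small-field class: `W` unitary, `0 ≤ x`, `LevelSmall d L j x`, `SmallField W x`, `M = L^{j+1}`):
`‖ξ y‖ ≤ m + θ_b·S + 2·d(M−1)·(G + 2(d−1)(M−1)x·S)`, `θ_b = 4d²(M−1)²x + 16d·loopRad d L (prop1Radius^[j] x)`. [folklore] -/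
theorem norm_le_of_bmeanIterW_le [Nonempty n] {L : ℕ} (hL : 2 ≤ L) (j : ℕ) {W : Site d → Fin d → (Matrix n n ℂ)ˣ} {x : ℝ}
    (hWu : IsUnitaryCfg W) (hx : 0 ≤ x) (hsm : LevelSmall d L j x) (hWx : SmallField W x)
    (ξ : Site d → Matrix n n ℂ) {m : ℝ} (hm : ∀ z, ‖bmeanIterW L (j + 1) W ξ z‖ ≤ m) {S G : ℝ} (hS : ∀ y, ‖ξ y‖ ≤ S) (hG : ∀ y μ, ‖gaugeDir W ξ y μ‖ ≤ G)
    (y : Site d) :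
    ‖ξ y‖ ≤ m + (4 * (d : ℝ) ^ 2 * ((L : ℝ) ^ (j + 1) - 1) ^ 2 * x + 16 * d * loopRad d L ((prop1Radius d L)^[j] x)) * S
        + 2 * (d * (((L ^ (j + 1) : ℕ) : ℝ) - 1) * (G + 2 * (((d : ℝ) - 1) * (((L ^ (j + 1) : ℕ) : ℝ) - 1) * x) * S)) := by
  have hL1 : 1 ≤ L := le_trans (by norm_num) hL
  have hM1 : 1 ≤ L ^ (j + 1) := Nat.one_le_pow _ _ (by omega)
  -- the block of `y`
  have hy0 : ((L ^ (j + 1) : ℕ) : ℤ) • blk (L ^ (j + 1)) y ≤ y := fun i => by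
    have h := congr_fun (blk_add_res (L ^ (j + 1)) y) i
    simp only [Pi.add_apply] at h
    have := res_nonneg hM1 y i
    linarith
  have hy1 : y ≤ ((L ^ (j + 1) : ℕ) : ℤ) • blk (L ^ (j + 1)) y + (fun _ => ((L ^ (j + 1) : ℕ) : ℤ) - 1) := fun i => by
    have h := congr_fun (blk_add_res (L ^ (j + 1)) y) i
    simp only [Pi.add_apply] at h ⊢
    have := res_le hM1 y i
    linarith
  -- (1) staircase from the corner; (2) corner versus the single-scale mean
  have h1 := norm_le_corner_add hM1 hWu hx hWx ξ hS hG (blk (L ^ (j + 1)) y) hy0 hy1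
  have h2 := norm_bmeanW_sub_corner_le hM1 hWu hx hWx ξ hS hG (blk (L ^ (j + 1)) y)
  -- (3) the single-scale mean versus the nested mean (`≤ m`)
  have h3 := norm_bmeanIterW_sub_bmeanW_le hL j hWu hx hsm hWx ξ (blk (L ^ (j + 1)) y)
  have hS0 : 0 ≤ S := (norm_nonneg _).trans (hS y)
  have havg : ((((L ^ (j + 1) : ℕ) : ℝ) ^ d)⁻¹ * ∑ v ∈ periodBox (d := d) (L ^ (j + 1)), ‖ξ (((L ^ (j + 1) : ℕ) : ℤ) • blk (L ^ (j + 1)) y + v)‖) ≤ S := by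
    have hMd : (0 : ℝ) < ((L ^ (j + 1) : ℕ) : ℝ) ^ d := by positivity
    rw [inv_mul_le_iff₀ hMd]
    have hsum : ∑ v ∈ periodBox (d := d) (L ^ (j + 1)), ‖ξ (((L ^ (j + 1) : ℕ) : ℤ) • blk (L ^ (j + 1)) y + v)‖
        ≤ ∑ _v ∈ periodBox (d := d) (L ^ (j + 1)), S := Finset.sum_le_sum fun v _ => hS _
    have hcard : ∑ _v ∈ periodBox (d := d) (L ^ (j + 1)), S = ((L ^ (j + 1) : ℕ) : ℝ) ^ d * S := by
      rw [Finset.sum_const, card_periodBox, nsmul_eq_mul]; push_cast; ring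
    linarith
  have hθ0 : 0 ≤ 4 * (d : ℝ) ^ 2 * ((L : ℝ) ^ (j + 1) - 1) ^ 2 * x + 16 * d * loopRad d L ((prop1Radius d L)^[j] x) := by
    have hr : 0 ≤ (prop1Radius d L)^[j] x := iterate_prop1Radius_nonneg j hx
    have : 0 ≤ loopRad d L ((prop1Radius d L)^[j] x) := by unfold loopRad; positivity
    positivity
  have h3' : ‖bmeanIterW L (j + 1) W ξ (blk (L ^ (j + 1)) y) - bmeanW (L ^ (j + 1)) W ξ (blk (L ^ (j + 1)) y)‖
      ≤ (4 * (d : ℝ) ^ 2 * ((L : ℝ) ^ (j + 1) - 1) ^ 2 * x + 16 * d * loopRad d L ((prop1Radius d L)^[j] x)) * S :=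
    h3.trans (mul_le_mul_of_nonneg_left havg hθ0)
  -- `‖bmeanW‖ ≤ ‖bmeanIterW‖ + ‖bmeanIterW − bmeanW‖ ≤ m + θ_b S`
  have h4 : ‖bmeanW (L ^ (j + 1)) W ξ (blk (L ^ (j + 1)) y)‖
      ≤ m + (4 * (d : ℝ) ^ 2 * ((L : ℝ) ^ (j + 1) - 1) ^ 2 * x + 16 * d * loopRad d L ((prop1Radius d L)^[j] x)) * S := by
    have hn := norm_le_norm_sub_add (bmeanW (L ^ (j + 1)) W ξ (blk (L ^ (j + 1)) y)) (bmeanIterW L (j + 1) W ξ (blk (L ^ (j + 1)) y))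
    rw [norm_sub_rev] at hn
    linarith [hm (blk (L ^ (j + 1)) y)]
  -- corner value
  have hcorner := norm_le_norm_sub_add (ξ (((L ^ (j + 1) : ℕ) : ℤ) • blk (L ^ (j + 1)) y)) (bmeanW (L ^ (j + 1)) W ξ (blk (L ^ (j + 1)) y))
  rw [norm_sub_rev] at hcorner
  linarith

/-! ## §2 THE LETTER: the sup is absorbed -/

/-- **THE SUP LETTER OF A GAUGE FUNCTION** (multi-level small-field class at level `j+1`, `M = L^{j+1}`): for a `P`-periodic (`P ≥ 1`) site field `ξ` with `‖bmeanIterW L (j+1) W ξ z‖ ≤ m`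
for all `z` and `‖gaugeDir W ξ y μ‖ ≤ G` for all bonds, IF `θ := 4d²(M−1)²x + 16d·loopRad d L (prop1Radius^[j] x) + 4d(d−1)(M−1)²x < 1`, THEN
`‖ξ y‖ ≤ (m + 2d(M−1)·G)∕(1 − θ)` for every `y` — ONE factor `M` in front of the gradient, none in front of the mean. [folklore] -/
theorem sup_le_of_bmeanIterW_le [Nonempty n] {L : ℕ} (hL : 2 ≤ L) (j : ℕ) {W : Site d → Fin d → (Matrix n n ℂ)ˣ} {x : ℝ}
    (hWu : IsUnitaryCfg W) (hx : 0 ≤ x) (hsm : LevelSmall d L j x) (hWx : SmallField W x)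
    (ξ : Site d → Matrix n n ℂ) {m : ℝ} (hm : ∀ z, ‖bmeanIterW L (j + 1) W ξ z‖ ≤ m) {P : ℕ} (hP : 1 ≤ P)
    (hξP : ∀ (y : Site d) (κ : Fin d), ξ (y + (P : ℤ) • e κ) = ξ y) {G : ℝ} (hG : ∀ y μ, ‖gaugeDir W ξ y μ‖ ≤ G)
    (hθ : 4 * (d : ℝ) ^ 2 * ((L : ℝ) ^ (j + 1) - 1) ^ 2 * x + 16 * d * loopRad d L ((prop1Radius d L)^[j] x)
        + 4 * d * ((d : ℝ) - 1) * ((L : ℝ) ^ (j + 1) - 1) ^ 2 * x < 1) (y : Site d) :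
    ‖ξ y‖ ≤ (m + 2 * d * ((L : ℝ) ^ (j + 1) - 1) * G)
        / (1 - (4 * (d : ℝ) ^ 2 * ((L : ℝ) ^ (j + 1) - 1) ^ 2 * x + 16 * d * loopRad d L ((prop1Radius d L)^[j] x)
            + 4 * d * ((d : ℝ) - 1) * ((L : ℝ) ^ (j + 1) - 1) ^ 2 * x)) := by
  -- the sup over the period box is attained and bounds `ξ` everywhere
  have hne : (periodBox (d := d) P).Nonempty := ⟨_, wrap_mem_periodBox P hP 0⟩
  obtain ⟨y₀, -, hy₀⟩ := Finset.exists_max_image (periodBox (d := d) P) (fun y => ‖ξ y‖) hne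
  have hS : ∀ y, ‖ξ y‖ ≤ ‖ξ y₀‖ := fun y => by
    rw [← apply_wrap_eq (g := ξ) hξP y]
    exact hy₀ _ (wrap_mem_periodBox P hP y)
  have hmain := norm_le_of_bmeanIterW_le hL j hWu hx hsm hWx ξ hm hS hG y₀
  have hMr : ((L ^ (j + 1) : ℕ) : ℝ) = (L : ℝ) ^ (j + 1) := by push_cast; rfl
  rw [hMr] at hmain
  set θb : ℝ := 4 * (d : ℝ) ^ 2 * ((L : ℝ) ^ (j + 1) - 1) ^ 2 * x + 16 * d * loopRad d L ((prop1Radius d L)^[j] x) with hθb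
  set m1 : ℝ := (L : ℝ) ^ (j + 1) - 1 with hm1
  have h1θ : 0 < 1 - (θb + 4 * d * ((d : ℝ) - 1) * m1 ^ 2 * x) := by linarith
  have hSle : ‖ξ y₀‖ ≤ (θb + 4 * d * ((d : ℝ) - 1) * m1 ^ 2 * x) * ‖ξ y₀‖ + (m + 2 * d * m1 * G) := by
    have e : m + θb * ‖ξ y₀‖ + 2 * (d * m1 * (G + 2 * (((d : ℝ) - 1) * m1 * x) * ‖ξ y₀‖))
        = (θb + 4 * d * ((d : ℝ) - 1) * m1 ^ 2 * x) * ‖ξ y₀‖ + (m + 2 * d * m1 * G) := by ring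
    rw [← e]; exact hmain
  have hSbound : ‖ξ y₀‖ ≤ (m + 2 * d * m1 * G) / (1 - (θb + 4 * d * ((d : ℝ) - 1) * m1 ^ 2 * x)) := by
    rw [le_div_iff₀ h1θ]
    have e2 : ‖ξ y₀‖ * (1 - (θb + 4 * d * ((d : ℝ) - 1) * m1 ^ 2 * x))
        = ‖ξ y₀‖ - (θb + 4 * d * ((d : ℝ) - 1) * m1 ^ 2 * x) * ‖ξ y₀‖ := by ring
    rw [e2]
    linarith
  exact (hS y).trans hSbound

/-! ## §3 The reading for a linear slice split -/

/-- **THE SIZE OF THE GAUGE FUNCTION OF A SPLIT**: in the same class, if `T = Ỹ + gaugeDir W ζ` pointwise with `‖T‖ ≤ S_T`, `‖Ỹ‖ ≤ S_Y`, `ζ` `P`-periodic with `‖bmeanIterW L (j+1) W ζ z‖ ≤ m`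
(for the spike-free split: `m = sup‖framePotW T − h‖`), and `θ < 1` as above, then `∀ y, ‖ζ y‖ ≤ (m + 2d(M−1)·(S_T + S_Y))∕(1 − θ)`. [folklore] -/
theorem sup_gauge_of_split [Nonempty n] {L : ℕ} (hL : 2 ≤ L) (j : ℕ) {W : Site d → Fin d → (Matrix n n ℂ)ˣ} {x : ℝ}
    (hWu : IsUnitaryCfg W) (hx : 0 ≤ x) (hsm : LevelSmall d L j x) (hWx : SmallField W x)
    {T Yt : Site d → Fin d → Matrix n n ℂ} {ζ : Site d → Matrix n n ℂ} (hsplit : ∀ y μ, T y μ = Yt y μ + gaugeDir W ζ y μ)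
    {S_T S_Y m : ℝ} (hT : ∀ y μ, ‖T y μ‖ ≤ S_T) (hY : ∀ y μ, ‖Yt y μ‖ ≤ S_Y) (hm : ∀ z, ‖bmeanIterW L (j + 1) W ζ z‖ ≤ m)
    {P : ℕ} (hP : 1 ≤ P) (hζP : ∀ (y : Site d) (κ : Fin d), ζ (y + (P : ℤ) • e κ) = ζ y)
    (hθ : 4 * (d : ℝ) ^ 2 * ((L : ℝ) ^ (j + 1) - 1) ^ 2 * x + 16 * d * loopRad d L ((prop1Radius d L)^[j] x)
        + 4 * d * ((d : ℝ) - 1) * ((L : ℝ) ^ (j + 1) - 1) ^ 2 * x < 1) (y : Site d) :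
    ‖ζ y‖ ≤ (m + 2 * d * ((L : ℝ) ^ (j + 1) - 1) * (S_T + S_Y))
        / (1 - (4 * (d : ℝ) ^ 2 * ((L : ℝ) ^ (j + 1) - 1) ^ 2 * x + 16 * d * loopRad d L ((prop1Radius d L)^[j] x)
            + 4 * d * ((d : ℝ) - 1) * ((L : ℝ) ^ (j + 1) - 1) ^ 2 * x)) := by
  have hG : ∀ y μ, ‖gaugeDir W ζ y μ‖ ≤ S_T + S_Y := fun y μ => by
    have e : gaugeDir W ζ y μ = T y μ - Yt y μ := by rw [hsplit y μ]; abel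
    rw [e]
    exact (norm_sub_le _ _).trans (add_le_add (hT y μ) (hY y μ))
  exact sup_le_of_bmeanIterW_le hL j hWu hx hsm hWx ζ hm hP hζP hG hθ y

end

end Summit.QuantumFields.BalabanUV.T4Continuum.NE7GaugeFunctionSupLetter
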